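import Summits.BirchSwinnertonDyer.Rank1Residual.GaloisImage.PropagatedStructureCartesian
import Summits.BirchSwinnertonDyer.Rank1Residual.GaloisImage.BigImTorsionLevels
import Summits.BirchSwinnertonDyer.Rank1Residual.X9.GaloisShear
import Literature.NumberTheory.GaloisCohomology.Sakamoto2024KolyvaginRankOne
import Literature.NumberTheory.EllipticCurves.NonEisensteinPrimeOfSurjective
import Literature.NumberTheory.GaloisRepresentations.CyclotomicLevels
import Literature.NumberTheory.EllipticCurves.PointDivisibilityProofs
import HarnessLib

/-!
# The N11 instance of Sakamoto's Theorem 4.4 (1): `KS₁(E[3^{k+1}], 𝓕_can)` is free of rank one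
# (cell `b2b-bsdres`, team n1011, row T-a3-F1, consumer of the named fact p254540)

Honest framing of the cell: research route; theorems only; the one cited input is the tree's named
fact `Literature.NumberTheory.GaloisCohomology.Sakamoto2024.kolyvaginSystems_freeRankOne_zmod_three_pow`
(R. Sakamoto, JTNB 36 (2024) Thm. 4.4 (1) for `R = ℤ/3^m`, `K = ℚ`), taken as the hypothesis
`hS24` — so the end theorem is CONDITIONAL on it (debt of the tree, visible in the signature).

For an elliptic curve `E/ℚ`, `T = E[3^{k+1}]` (`geomTorsion W (3^k · 3)`), `T̄ = E[3]`, the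
residual pair `[3^k] : E[3^{k+1}] ↠ E[3]`, `E[3] ↪ E[3^{k+1}]`, and the Mazur–Rubin structure
`𝓕_can = propagatedSelmerStructure W 3 k` propagated from `T₃E` (n1011-p13,
`PropagatedStructure.lean`), this file discharges the following hypotheses of the fact by theorems
of the tree and leaves the rest explicit:

* DISCHARGED: the residual pair is Sakamoto's (`torsionMulBy_pow_surjective` — divisibility of
  `E(ℚ̄)`; `torsionMulBy_pow_eq_zero_iff` — `ker [3^k] = 3·E[3^{k+1}]`;
  `torsionInclusion_torsionMulBy_pow` — `incl ∘ red = 3^k`); `E[3^{k+1}]` is a finite free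
  `ℤ/3^{k+1}`-module (instances `instModuleZModGeomTorsionPowMul`, `…Finite…`, `…Free…`, the last
  from a `ℤ₃`-basis of `T₃E`: `nonempty_linearEquiv_prod_geomTorsion`); (H.1) from surjectivity
  mod `3` (`residual_irreducible_of_surj`); (H.2) at level `3^{k+1}` from the `3`-adic tower
  (`exists_rootsOfUnityFixer_cokerSubOne_equiv_of_towerSurj`, p251128 transported to the fact's
  spelling — its `τ` enters the end theorem as data because Sakamoto's prime set `𝒫` depends on
  it); cartesian at every place (p253969 `isCartesian_propagatedSelmerStructure`); the residual
  structure is `𝓕̄ = propagatedSelmerStructureOne W 3` (`induced_propagatedSelmerStructure`).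
* EXPLICIT (binders of `kolyvaginSystems_freeRankOne_propagatedSelmerStructure`, nothing hidden):
  the tower; (H.3) at level `k+1` (inflation–restriction form); (H.SD) `θ` bijective; the
  Poitou–Tate family `inv` (four properties) and `S(𝓕)` with `𝓕_can` unramified outside `S`;
  **core rank one of `𝓕̄`** (cells/n1011/skel/T-a3-F1-CR.md — the located gap, local at `3`);
  residual coisotropy of `𝓕̄` (a theorem of n1011-p18's `PropagatedConditionCoisotropic.lean` for
  `θ = weilDualIntertwining …`; a binder here to stay agnostic of the Weil data); the Kolyvagin
  datum `D` with Sakamoto's primes, cyclotomic transverse conditions and THE canonical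
  finite–singular comparison maps (`HasCanonicalComparison`).

References: Sakamoto 2024 §2, Thm. 4.4; B. Mazur, K. Rubin, Mem. AMS 799 (2004) Exa. 1.1.7, §3.5.
-/

noncomputable section

open scoped Classical NumberField ContRepresentation
open Field NumberField IsDedekindDomain
open WeierstrassCurve Literature.NumberTheory.EllipticCurves Literature.NumberTheory.GaloisRepresentations
  Literature.NumberTheory.GaloisRepresentations.DiscreteGaloisModule Literature.NumberTheory.GaloisCohomology

namespace Summit.BirchSwinnertonDyer.Rank1Residual.GaloisImage

variable (W : WeierstrassCurve ℚ) [W.IsElliptic] (p : ℕ) [hp : Fact p.Prime]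

/-! ### The residual pair `[p^k] : E[p^{k+1}] ↠ E[p]`, `E[p] ↪ E[p^{k+1}]` is Sakamoto's -/

/-- `[p^k] : E[p^{k+1}] → E[p]` is onto (divisibility of `E(ℚ̄)`). [folklore] -/
theorem torsionMulBy_pow_surjective (k : ℕ) :
    Function.Surjective (W.torsionMulBy ((p : ℤ) ^ k) (p : ℤ)) := by
  intro Q
  have hk : ((p : ℤ) ^ k) ≠ 0 := pow_ne_zero k (Int.natCast_ne_zero.mpr hp.out.ne_zero)
  obtain ⟨R, hR⟩ := (W.baseChange (AlgebraicClosure ℚ)).zsmul_surjective_of_isAlgClosed hk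
    (Q : geomPoints W)
  have hRmem : (R : geomPoints W) ∈ geomTorsion W ((p : ℤ) ^ k * (p : ℤ)) := by
    refine (mem_geomTorsion_iff W _ _).mpr ?_
    rw [mul_comm, mul_zsmul]
    have hR' : (p : ℤ) ^ k • R = (Q : geomPoints W) := hR
    change (p : ℤ) • ((p : ℤ) ^ k • R) = 0
    rw [hR']
    exact (mem_geomTorsion_iff W _ _).mp Q.2
  refine ⟨⟨R, hRmem⟩, Subtype.ext ?_⟩
  rw [coe_torsionMulBy_apply]
  exact (hR : _)

/-- `ker [p^k] = p · E[p^{k+1}]` on `E[p^{k+1}]`. [folklore] -/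
theorem torsionMulBy_pow_eq_zero_iff (k : ℕ) (x : geomTorsion W ((p : ℤ) ^ k * (p : ℤ))) :
    W.torsionMulBy ((p : ℤ) ^ k) (p : ℤ) x = 0 ↔
      ∃ y : geomTorsion W ((p : ℤ) ^ k * (p : ℤ)), x = (p : ℤ) • y := by
  constructor
  · intro hx
    have hx' : ((p : ℤ) ^ k) • (x : geomPoints W) = 0 := by
      have := congrArg (fun P : geomTorsion W (p : ℤ) => (P : geomPoints W)) hx
      simpa [coe_torsionMulBy_apply] using this
    obtain ⟨y, hy⟩ := (W.baseChange (AlgebraicClosure ℚ)).zsmul_surjective_of_isAlgClosed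
      (Int.natCast_ne_zero.mpr hp.out.ne_zero : (p : ℤ) ≠ 0) (x : geomPoints W)
    have hymem : (y : geomPoints W) ∈ geomTorsion W ((p : ℤ) ^ k * (p : ℤ)) := by
      refine (mem_geomTorsion_iff W _ _).mpr ?_
      rw [mul_zsmul]
      have hy' : (p : ℤ) • y = (x : geomPoints W) := hy
      change (p : ℤ) ^ k • ((p : ℤ) • y) = 0
      rw [hy']
      exact hx'
    exact ⟨⟨y, hymem⟩, Subtype.ext (by rw [AddSubgroupClass.coe_zsmul]; exact (hy.symm : _))⟩
  · rintro ⟨y, rfl⟩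
    apply Subtype.ext
    rw [coe_torsionMulBy_apply, AddSubgroupClass.coe_zsmul, ZeroMemClass.coe_zero, smul_smul]
    exact (mem_geomTorsion_iff W _ _).mp y.2

omit [W.IsElliptic] hp in
/-- `incl ∘ [p^k] = p^k` on `E[p^{k+1}]` (Sakamoto's fixed injection `T̄ ↪ T`, §3.1.1). [folklore] -/
theorem torsionInclusion_torsionMulBy_pow (k : ℕ) (x : geomTorsion W ((p : ℤ) ^ k * (p : ℤ))) :
    W.torsionInclusion (Dvd.intro_left _ rfl) (W.torsionMulBy ((p : ℤ) ^ k) (p : ℤ) x) =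
      ((p : ℤ) ^ (k + 1 - 1)) • x := by
  apply Subtype.ext
  rw [coe_torsionInclusion_apply, coe_torsionMulBy_apply, AddSubgroupClass.coe_zsmul,
    Nat.add_sub_cancel]

/-! ### `E[p^{k+1}]` as a free `ℤ/p^{k+1}`-module of finite rank -/

omit hp in
/-- `E[p^k · p]` is finite. [folklore] -/
theorem finite_geomTorsion_pow_mul (k : ℕ) [Fact p.Prime] :
    Finite (geomTorsion W ((p : ℤ) ^ k * (p : ℤ))) :=
  finite_torsionPoints_holds W (AlgebraicClosure ℚ)
    (mul_ne_zero (pow_ne_zero k (Int.natCast_ne_zero.mpr (Fact.out : p.Prime).ne_zero))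
      (Int.natCast_ne_zero.mpr (Fact.out : p.Prime).ne_zero))

omit [W.IsElliptic] hp in
/-- `E[p^k · p]` is killed by `p^{k+1}`. [folklore] -/
theorem pow_succ_nsmul_geomTorsion_eq_zero (k : ℕ) (x : geomTorsion W ((p : ℤ) ^ k * (p : ℤ))) :
    p ^ (k + 1) • x = 0 := by
  apply Subtype.ext
  rw [AddSubmonoidClass.coe_nsmul, ZeroMemClass.coe_zero, ← natCast_zsmul, Nat.cast_pow, pow_succ]
  exact (mem_geomTorsion_iff W _ _).mp x.2

/-- The `ℤ/p^{k+1}`-module structure of `E[p^k · p]` (the unique one on a group killed by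
`p^{k+1}`). [folklore] -/
instance instModuleZModGeomTorsionPowMul (k : ℕ) :
    Module (ZMod (p ^ (k + 1))) (geomTorsion W ((p : ℤ) ^ k * (p : ℤ))) :=
  AddCommGroup.zmodModule (pow_succ_nsmul_geomTorsion_eq_zero W p k)

/-- `E[p^k · p]` is a finite `ℤ/p^{k+1}`-module. [folklore] -/
instance instModuleFiniteZModGeomTorsionPowMul (k : ℕ) :
    Module.Finite (ZMod (p ^ (k + 1))) (geomTorsion W ((p : ℤ) ^ k * (p : ℤ))) :=
  haveI := finite_geomTorsion_pow_mul W p k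
  Module.Finite.of_finite

/-- A `ℤ/p^{k+1}`-linear isomorphism `(ℤ/p^{k+1})² ≃ E[p^k · p]`: the level-`(k+1)` truncation of
a `ℤ_p`-basis of `T_pE` (`TateModule.levelMap`, bijective by the tree's `#E[p^j] = p^{2j}`).
[folklore] -/
theorem nonempty_linearEquiv_prod_geomTorsion (k : ℕ) :
    Nonempty ((ZMod (p ^ (k + 1)) × ZMod (p ^ (k + 1))) ≃ₗ[ZMod (p ^ (k + 1))]
      geomTorsion W ((p : ℤ) ^ k * (p : ℤ))) := by
  have hpQ : (p : ℚ) ≠ 0 := Nat.cast_ne_zero.mpr hp.out.ne_zero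
  have hc : ∀ j : ℕ, Nat.card (geomTorsion W ((p ^ j : ℕ) : ℤ)) = p ^ (2 * j) :=
    card_geomTorsion_pow_eq W p (card_torsionPoints_eq_sq_holds W (AlgebraicClosure ℚ)) hpQ
  obtain ⟨P₁, hP₁, Q₁, hQ₁, hgen₁⟩ :=
    TateModule.exists_generators_of_card_torsionBy (A := geomPoints W) (p := p) (by simpa using hc 1)
  have hs := TateModule.exists_smul_eq_of_card_torsionBy (A := geomPoints W) hc
  obtain ⟨a, ha⟩ := TateModule.exists_proj_one_eq (A := geomPoints W) (fun k P hP ↦ hs k hP) hP₁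
  obtain ⟨b, hb⟩ := TateModule.exists_proj_one_eq (A := geomPoints W) (fun k P hP ↦ hs k hP) hQ₁
  have hgen : ∀ R ∈ geomTorsion W ((p : ℕ) : ℤ), ∃ m n : ℤ,
      m • TateModule.proj p 1 a + n • TateModule.proj p 1 b = R := by
    rw [ha, hb]; exact hgen₁
  have hlev : Function.Bijective (TateModule.levelMap p a b (k + 1)) :=
    TateModule.levelMap_bijective a b hc hgen (k + 1)
  haveI : NeZero (p ^ (k + 1)) := ⟨pow_ne_zero _ hp.out.ne_zero⟩
  have hlevel : geomTorsion W ((p ^ (k + 1) : ℕ) : ℤ) = geomTorsion W ((p : ℤ) ^ k * (p : ℤ)) := by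
    rw [Nat.cast_pow, pow_succ]
  have hmem : ∀ P : geomPoints W,
      P ∈ geomTorsion W ((p ^ (k + 1) : ℕ) : ℤ) ↔ P ∈ geomTorsion W ((p : ℤ) ^ k * (p : ℤ)) :=
    fun P => by rw [hlevel]
  have ha : TateModule.proj p (k + 1) a ∈ geomTorsion W ((p ^ (k + 1) : ℕ) : ℤ) :=
    TateModule.proj_mem_torsionBy (k + 1) a
  have hb : TateModule.proj p (k + 1) b ∈ geomTorsion W ((p ^ (k + 1) : ℕ) : ℤ) :=
    TateModule.proj_mem_torsionBy (k + 1) b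
  let L : ZMod (p ^ (k + 1)) × ZMod (p ^ (k + 1)) → geomTorsion W ((p : ℤ) ^ k * (p : ℤ)) :=
    fun xy => ⟨(TateModule.levelMap p a b (k + 1) xy : geomPoints W),
      (hmem _).mp (TateModule.levelMap p a b (k + 1) xy).2⟩
  have hL : ∀ xy, (L xy : geomPoints W) =
      xy.1.val • TateModule.proj p (k + 1) a + xy.2.val • TateModule.proj p (k + 1) b :=
    fun xy => rfl
  have hLadd : ∀ x y, L (x + y) = L x + L y := fun x y => by
    apply Subtype.ext
    rw [AddSubgroup.coe_add, hL, hL, hL]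
    exact X9.val_smul_frame_add W ha hb x y
  have hLbij : Function.Bijective L := by
    refine ⟨fun x y hxy => hlev.1 (Subtype.ext (congrArg (fun P : geomTorsion W _ =>
      (P : geomPoints W)) hxy)), fun z => ?_⟩
    obtain ⟨xy, hxy⟩ := hlev.2 ⟨(z : geomPoints W), (hmem _).mpr z.2⟩
    refine ⟨xy, Subtype.ext ?_⟩
    have := congrArg (fun P : geomTorsion W ((p ^ (k + 1) : ℕ) : ℤ) => (P : geomPoints W)) hxy
    rw [hL]
    simpa [TateModule.coe_levelMap] using this
  let Le : (ZMod (p ^ (k + 1)) × ZMod (p ^ (k + 1))) ≃+ geomTorsion W ((p : ℤ) ^ k * (p : ℤ)) :=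
    AddEquiv.ofBijective (AddMonoidHom.mk' L hLadd) hLbij
  exact ⟨LinearEquiv.ofBijective (Le.toAddMonoidHom.toZModLinearMap (p ^ (k + 1)))
    (by rw [AddMonoidHom.coe_toZModLinearMap]; exact Le.bijective)⟩

/-- `E[p^k · p]` is free (of rank two) over `ℤ/p^{k+1}`. [folklore] -/
instance instModuleFreeZModGeomTorsionPowMul (k : ℕ) :
    Module.Free (ZMod (p ^ (k + 1))) (geomTorsion W ((p : ℤ) ^ k * (p : ℤ))) :=
  (nonempty_linearEquiv_prod_geomTorsion W p k).elim fun e => Module.Free.of_equiv e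

/-! ### (H.1) and (H.2) in the fact's spelling -/

/-- **(H.1)** in the fact's spelling, from surjectivity mod `p`. [folklore] -/
theorem residual_irreducible_of_surj [NeZero (p : ℚ)] (h : W.HasSurjectiveModNGaloisRep (p : ℤ))
    (H : AddSubgroup (geomTorsion W (p : ℤ)))
    (hH : ∀ (σ : absoluteGaloisGroup ℚ) (x : geomTorsion W (p : ℤ)), x ∈ H →
      (W.torsionGaloisModule (p : ℤ)) σ x ∈ H) :
    H = ⊥ ∨ H = ⊤ :=
  hasIrreducibleModPGaloisRep_of_hasSurjectiveModNGaloisRep W p h H fun σ P hP => by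
    have := hH σ P hP
    rwa [torsionGaloisModule_apply_apply] at this

/-- **(H.2) at level `p^{k+1}`** in the fact's spelling, from the tower: a `τ` fixing `μ_{p^{k+1}}`
with `E[p^{k+1}]/(τ − 1) ≃ ℤ/p^{k+1}` (p251128 `exists_torsion_quotient_equiv_zmod_of_towerSurj`,
transported from the level spelling `p^{k+1}` to `p^k · p`). [folklore] -/
theorem exists_rootsOfUnityFixer_cokerSubOne_equiv_of_towerSurj (k : ℕ)
    (htower : ∀ n : ℕ, W.HasSurjectiveModNGaloisRep (p ^ n : ℕ)) :
    ∃ τ : absoluteGaloisGroup ℚ, τ ∈ rootsOfUnityFixer ℚ (p ^ (k + 1)) ∧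
      Nonempty (cokerSubOne (W.torsionGaloisModule ((p : ℤ) ^ k * (p : ℤ))) τ ≃+
        ZMod (p ^ (k + 1))) := by
  obtain ⟨σ, hσ, hq⟩ := exists_torsion_quotient_equiv_zmod_of_towerSurj W p htower
  refine ⟨σ, mem_rootsOfUnityFixer_iff.mpr (fun t ht => hσ (k + 1) t ht), ?_⟩
  have h := hq (k + 1)
  have hlevel : ((p ^ (k + 1) : ℕ) : ℤ) = (p : ℤ) ^ k * (p : ℤ) := by rw [Nat.cast_pow, pow_succ]
  rw [hlevel] at h
  have hf : ((W.torsionGaloisModule ((p : ℤ) ^ k * (p : ℤ))) σ).toAddMonoidHom =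
      (Multiplicative.toAdd (galoisRepTorsion W ((p : ℤ) ^ k * (p : ℤ)) σ)).toAddMonoidHom :=
    AddMonoidHom.ext fun x => by
      rw [LinearMap.toAddMonoidHom_coe, torsionGaloisModule_apply_apply]; rfl
  change Nonempty (geomTorsion W _ ⧸ (((W.torsionGaloisModule _) σ).toAddMonoidHom -
    AddMonoidHom.id _).range ≃+ _)
  rw [hf]
  exact h

/-! ### The instance -/

/-- **The N11 instance of Sakamoto's Theorem 4.4 (1)** (`T = E[3^{k+1}]`, `𝓕 = 𝓕_can` = the
Mazur–Rubin structure propagated from `T₃E`, `propagatedSelmerStructure W 3 k`): from the tree's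
named fact `Sakamoto2024.kolyvaginSystems_freeRankOne_zmod_three_pow` (hypothesis `hS24`), the
module `KS₁(E[3^{k+1}], 𝓕_can, 𝒫)` is free of rank one over `ℤ/3^{k+1}` and the projections
`κ ↦ κ_d` at levels with `λ^*(d) = 0` are bijective — with the following hypotheses of the fact
DISCHARGED here by theorems of the tree: the residual pair is `[3^k] : E[3^{k+1}] ↠ E[3]` /
`E[3] ↪ E[3^{k+1}]` (`torsionMulBy_pow_surjective`, `torsionMulBy_pow_eq_zero_iff`,
`torsionInclusion_torsionMulBy_pow`); `E[3^{k+1}]` is free of finite rank over `ℤ/3^{k+1}`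
(instances above); (H.1) from surjectivity mod `3` (`residual_irreducible_of_surj`); cartesian
(Def. 3.5) at every place (`isCartesian_propagatedSelmerStructure`, p253969); the hypotheses on
the residual structure are read on `𝓕̄ = propagatedSelmerStructureOne W 3`
(`induced_propagatedSelmerStructure`). The hypotheses that REMAIN EXPLICIT (nothing hidden):
the tower (for (H.2), whose `τ` is supplied by `exists_rootsOfUnityFixer_cokerSubOne_equiv_of_towerSurj`
and entered here as data because Sakamoto's `𝒫` depends on it); (H.3) at level `k+1` in the
fact's inflation–restriction form; (H.SD) `θ` bijective (Weil pairing, cf.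
`weilDualIntertwining`); the Poitou–Tate family `inv` and `S(𝓕)`; **core rank one** of `𝓕̄`
(skel/T-a3-F1-CR: the located gap (Lp)); residual coisotropy of `𝓕̄` (a THEOREM of n1011-p18's
`PropagatedConditionCoisotropic` for `θ = weilDualIntertwining …`, kept as a binder here to stay
agnostic of the Weil data); the two `Finite` instance binders (theorems: `finite_geomTorsion_pow_mul`, `finite_torsionPoints_holds`; binders only to avoid local instances); and the Kolyvagin datum with Sakamoto's primes, the cyclotomic
transverse conditions and THE canonical finite–singular comparison maps. CONDITIONAL on the named
fact `hS24` (Sakamoto 2024 Thm. 4.4, debt of the tree). [folklore] -/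
theorem kolyvaginSystems_freeRankOne_propagatedSelmerStructure
    (hS24 : Sakamoto2024.kolyvaginSystems_freeRankOne_zmod_three_pow) (k : ℕ)
    [Finite (geomTorsion W ((3 : ℕ) : ℤ))] [Finite (geomTorsion W (((3 : ℕ) : ℤ) ^ k * ((3 : ℕ) : ℤ)))]
    (htower : ∀ n : ℕ, W.HasSurjectiveModNGaloisRep (3 ^ n : ℕ))
    (τ : absoluteGaloisGroup ℚ) (hτμ : τ ∈ rootsOfUnityFixer ℚ (3 ^ (k + 1)))
    (hτq : Nonempty (cokerSubOne (W.torsionGaloisModule (((3 : ℕ) : ℤ) ^ k * ((3 : ℕ) : ℤ))) τ ≃+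
      ZMod (3 ^ (k + 1))))
    (hH3 : ∀ f : contOneCocycles (W.torsionGaloisModule ((3 : ℕ) : ℤ)).toTopRep,
      (∀ u : absoluteGaloisGroup ℚ, (W.torsionGaloisModule (((3 : ℕ) : ℤ) ^ k * ((3 : ℕ) : ℤ))) u = 1 →
        u ∈ rootsOfUnityFixer ℚ (3 ^ (k + 1)) → f.1 u = 0) →
        oneCocycleClass (W.torsionGaloisModule ((3 : ℕ) : ℤ)).toTopRep f = 0)
    (θ : (W.torsionGaloisModule ((3 : ℕ) : ℤ)).toContRepresentation →ⁱL
      ((W.torsionGaloisModule ((3 : ℕ) : ℤ)).tateDual 3).toContRepresentation)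
    (hθ : Function.Bijective θ)
    (inv : LocalInvariants ℚ 3) (hperf : inv.IsPerfect) (hsum : inv.SumLocalTermEqZero)
    (hunro : inv.UnramifiedOrthogonal) (hcompl : inv.SelmerComplement)
    (S : Finset (Place ℚ)) (hS : ∀ w : InfinitePlace ℚ, (Sum.inl w : Place ℚ) ∈ S)
    (hS' : ∀ v : HeightOneSpectrum (𝓞 ℚ), (Sum.inr v : Place ℚ) ∉ S →
      ((3 : ℕ) : 𝓞 ℚ) ∉ v.asIdeal ∧ GaloisRep.IsUnramifiedAt v (W.torsionGaloisModule (((3 : ℕ) : ℤ) ^ k * ((3 : ℕ) : ℤ))))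
    (hunr : (propagatedSelmerStructure W 3 k).IsUnramifiedOutside S)
    (hCR : LocalInvariants.HasCoreRank inv (propagatedSelmerStructureOne W 3) 3 1)
    (hco : inv.IsResiduallyCoisotropic (propagatedSelmerStructureOne W 3) θ S)
    (D : KolyvaginDatum (W.torsionGaloisModule (((3 : ℕ) : ℤ) ^ k * ((3 : ℕ) : ℤ))))
    (η : (q : HeightOneSpectrum (𝓞 ℚ)) → (ZMod (Ideal.absNorm q.asIdeal))ˣ)
    (hP : D.primes = frobeniusClassPrimes (W.torsionGaloisModule (((3 : ℕ) : ℤ) ^ k * ((3 : ℕ) : ℤ)))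
      {v | (Sum.inr v : Place ℚ) ∈ S} τ (3 ^ (k + 1)))
    (hT : D.transverse = cyclotomicTransverse (W.torsionGaloisModule (((3 : ℕ) : ℤ) ^ k * ((3 : ℕ) : ℤ))))
    (hD : D.HasCanonicalComparison (3 ^ (k + 1)) η) :
    KolyvaginSystem.IsFreeRankOneZMod (D.kolyvaginSystems (propagatedSelmerStructure W 3 k))
        (3 ^ (k + 1)) ∧
      ∀ (d : Finset (HeightOneSpectrum (𝓞 ℚ))) (hd : D.IsLevel d),
        LocalInvariants.lambdaStar inv ((D.atLevel (propagatedSelmerStructure W 3 k) d).induced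
          (W.torsionMulBy (((3 : ℕ) : ℤ) ^ k) ((3 : ℕ) : ℤ))) 3 = 0 →
        Function.Bijective fun κ : D.kolyvaginSystems (propagatedSelmerStructure W 3 k) =>
          (⟨κ.1 d, ((KolyvaginDatum.mem_kolyvaginSystems_iff D _ κ.1).mp κ.2).mem_selmerGroup
              d hd⟩ : (D.atLevel (propagatedSelmerStructure W 3 k) d).selmerGroup) := by
  haveI : NeZero ((3 : ℕ) : ℚ) := ⟨by norm_num⟩
  have h3 : W.HasSurjectiveModNGaloisRep ((3 : ℕ) : ℤ) := by simpa using htower 1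
  have hcart := isCartesian_propagatedSelmerStructure W 3 k S
  have hCR' : LocalInvariants.HasCoreRank inv
      ((propagatedSelmerStructure W 3 k).induced (W.torsionMulBy (((3 : ℕ) : ℤ) ^ k) ((3 : ℕ) : ℤ))) 3 1 := by
    rw [induced_propagatedSelmerStructure]; exact hCR
  have hco' : inv.IsResiduallyCoisotropic
      ((propagatedSelmerStructure W 3 k).induced (W.torsionMulBy (((3 : ℕ) : ℤ) ^ k) ((3 : ℕ) : ℤ))) θ S := by
    rw [induced_propagatedSelmerStructure]; exact hco
  exact hS24 (geomTorsion W (((3 : ℕ) : ℤ) ^ k * ((3 : ℕ) : ℤ))) (geomTorsion W ((3 : ℕ) : ℤ)) (k + 1)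
    (W.torsionGaloisModule _) (W.torsionGaloisModule _) (W.torsionMulBy (((3 : ℕ) : ℤ) ^ k) ((3 : ℕ) : ℤ))
    (W.torsionInclusion (Dvd.intro_left _ rfl)) τ θ inv S (propagatedSelmerStructure W 3 k) D η
    (torsionMulBy_pow_surjective W 3 k) (torsionMulBy_pow_eq_zero_iff W 3 k)
    (torsionInclusion_torsionMulBy_pow W 3 k) (residual_irreducible_of_surj W 3 h3) hτμ hτq
    hH3 hθ hperf hsum hunro hcompl hS hS' hunr hcart hCR' hco' hP hT hD

end Summit.BirchSwinnertonDyer.Rank1Residual.GaloisImage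

end
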